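import Mathlib
import HarnessLib

/-!
# Continuous characters of the circle group `U(1)`

Bröcker–tom Dieck, *Representations of Compact Lie Groups* (GTM 98, 1985), Ch. II, Proposition (8.1)
[BrockerTomDieck1985]: the irreducible complex representations of `S¹` are the characters `z ↦ z ^ m`,
`m ∈ ℤ`; equivalently, every continuous group homomorphism `S¹ → S¹` is a power map, and the exponent is
unique (the character group of `S¹` is `ℤ`).  Mathlib has the Pontryagin dual as an object
(`PontryaginDual`) and the uniqueness of circle exponents in various guises, but not this classification;
the tree had only the uniqueness half (`Literature.NumberTheory.Automorphic.circle_exponent_unique`).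

## Contents (everything is kernel-proved, pure Mathlib)

* `CircleChar.eq_zpow` : a continuous group homomorphism `χ : Circle →* Circle` is `z ↦ z ^ n` for some
  `n : ℤ`; `CircleChar.zpow_injective'` : the exponent is unique; packaged as
  `CircleChar.existsUnique_zpow : ∃! n : ℤ, ∀ z, χ z = z ^ n` (Prop. II.8.1);
* `CircleChar.norm_eq_one` : a continuous multiplicative character `χ : Circle →* ℂ` is automatically
  unitary (the image of a compact group in `ℂˣ` is bounded, hence lies on the unit circle), so
  `CircleChar.existsUnique_zpow_complex : ∃! n : ℤ, ∀ z, χ z = (z : ℂ) ^ n`;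
* `CircleChar.existsUnique_lineExponent` : a multiplicative action of `U(1)` on a complex normed space by
  continuous linear maps which stabilises the line through a non-zero vector `φ` and is continuous on it
  acts there by `u ↦ u ^ (-e)` for a UNIQUE `e : ℤ` — the form in which (8.1) is used to DEFINE integer
  invariants ("weights", Def. II.8.2) of a circle action on an isotypic line.

## Method

Lift `t ↦ χ (exp (i t))` through the covering map `Circle.exp : ℝ → U(1)`
(`IsCoveringMap.existsUnique_continuousMap_lifts`; `ℝ` is simply connected and locally path connected),
show the lift is additive by uniqueness of lifts, hence real-linear (`map_real_smul`), and read off the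
integer from `exp (F (2π)) = 1` — the commutative diagram of the proof of (8.1), loc. cit.

## Provenance

Staged by the pub-hodgecm formalisation cell (DAG-node prover #01 lineage) under the LEAN-IN-TREE rule; it
supersedes, re-sourced to print, the cell's standalone package file `HodgeCM/PerL34/CircleCharacters.lean`
(same declarations, namespace `HodgeCM.PerL34.CircleChar` ↦ `Literature.RepresentationTheory.CompactGroups.CircleChar`).

## Not here

The characters of higher tori `Tⁿ` (second half of Prop. II.8.1) and Pontryagin duality `(S¹)^ ≅ ℤ` as an
isomorphism of topological groups.
-/

set_option autoImplicit false

noncomputable section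

open Complex

namespace Literature.RepresentationTheory.CompactGroups

namespace CircleChar

/-- The pulled-back one-parameter map `t ↦ χ (exp (i t))` of a continuous endomorphism `χ` of `U(1)`.
[folklore] -/
def pull (χ : Circle →* Circle) (hχ : Continuous χ) : C(ℝ, Circle) :=
  ⟨fun t => χ (Circle.exp t), hχ.comp Circle.exp.continuous⟩

/-- Unfolding `pull`. [folklore] -/
@[simp] theorem pull_apply (χ : Circle →* Circle) (hχ : Continuous χ) (t : ℝ) :
    pull χ hχ t = χ (Circle.exp t) := rfl

/-- A continuous lift of `t ↦ χ (exp (i t))` through `Circle.exp`, normalised by `F 0 = 0`, exists and is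
unique (path lifting for the universal cover `ℝ → S¹`). [folklore] -/
theorem existsUnique_lift (χ : Circle →* Circle) (hχ : Continuous χ) :
    ∃! F : C(ℝ, ℝ), F 0 = 0 ∧ Circle.exp ∘ F = pull χ hχ :=
  Circle.isCoveringMap_exp.existsUnique_continuousMap_lifts (pull χ hχ) 0 0 (by simp)

/-- The normalised lift is additive (uniqueness of lifts applied to `t ↦ F (s + t) - F s`). [folklore] -/
theorem lift_add (χ : Circle →* Circle) (hχ : Continuous χ) (F : C(ℝ, ℝ))
    (hF : Circle.exp ∘ F = pull χ hχ)
    (huniq : ∀ G : C(ℝ, ℝ), G 0 = 0 ∧ Circle.exp ∘ G = pull χ hχ → G = F) (s t : ℝ) :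
    F (s + t) = F s + F t := by
  have hFt : ∀ r, Circle.exp (F r) = χ (Circle.exp r) := fun r => congrFun hF r
  let G : C(ℝ, ℝ) := ⟨fun r => F (s + r) - F s, by fun_prop⟩
  have hG0 : G 0 = 0 := by simp [G]
  have hG : Circle.exp ∘ G = pull χ hχ := by
    funext r
    simp only [Function.comp_apply, G, ContinuousMap.coe_mk, Circle.exp_sub, hFt, Circle.exp_add,
      map_mul, pull_apply]
    rw [mul_comm, mul_div_assoc, div_self', mul_one]
  have hGF : G = F := huniq G ⟨hG0, hG⟩
  have := congrFun (congrArg DFunLike.coe hGF) t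
  simp only [G, ContinuousMap.coe_mk] at this
  linarith

/-- **Every continuous endomorphism of `U(1)` is a power map** `z ↦ z ^ n`, `n ∈ ℤ`.
[cite: BrockerTomDieck1985, Ch. II Prop. 8.1] -/
theorem eq_zpow (χ : Circle →* Circle) (hχ : Continuous χ) : ∃ n : ℤ, ∀ z : Circle, χ z = z ^ n := by
  obtain ⟨F, ⟨hF0, hF⟩, huniq⟩ := existsUnique_lift χ hχ
  have hFt : ∀ r, Circle.exp (F r) = χ (Circle.exp r) := fun r => congrFun hF r
  have hadd : ∀ s t, F (s + t) = F s + F t :=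
    lift_add χ hχ F hF (fun G hG => huniq G hG)
  -- `F` is a continuous additive map `ℝ → ℝ`, hence real-linear
  let Fh : ℝ →+ ℝ := { toFun := F, map_zero' := hF0, map_add' := hadd }
  have hlin : ∀ t : ℝ, F t = t * F 1 := by
    intro t
    have h := map_real_smul Fh F.continuous t (1 : ℝ)
    simpa [Fh, smul_eq_mul] using h
  -- the period forces an integer slope
  have h2π : Circle.exp (F (2 * Real.pi)) = 1 := by rw [hFt, Circle.exp_two_pi, map_one]
  obtain ⟨n, hn⟩ := Circle.exp_eq_one.mp h2π
  have hslope : F 1 = n := by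
    have h := hlin (2 * Real.pi)
    rw [hn] at h
    have hπ : (2 * Real.pi) ≠ 0 := by positivity
    field_simp at h
    linarith
  refine ⟨n, fun z => ?_⟩
  obtain ⟨t, rfl⟩ := Circle.exp_surjective z
  rw [← hFt, hlin, hslope, mul_comm, Circle.exp_intCast_mul]

/-- The exponent of a power map on `U(1)` is determined by the map (evaluate `z ^ (n - m) = 1` at
`exp (i π / (n - m))`). [cite: BrockerTomDieck1985, Ch. II Prop. 8.1] -/
theorem zpow_injective' {n m : ℤ} (h : ∀ z : Circle, z ^ n = z ^ m) : n = m := by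
  by_contra hne
  have hd : (n - m : ℤ) ≠ 0 := sub_ne_zero.mpr hne
  have hd' : ((n - m : ℤ) : ℝ) ≠ 0 := by exact_mod_cast hd
  have h1 : ∀ z : Circle, z ^ (n - m) = 1 := fun z => by rw [zpow_sub, h z, mul_inv_cancel]
  have h2 := h1 (Circle.exp (Real.pi / ((n - m : ℤ) : ℝ)))
  rw [← Circle.exp_intCast_mul] at h2
  have h3 : ((n - m : ℤ) : ℝ) * (Real.pi / ((n - m : ℤ) : ℝ)) = Real.pi := by field_simp
  rw [h3] at h2
  exact Circle.exp_pi_ne_one h2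

/-- **Classification of the continuous characters of `U(1)`**: `∃! n : ℤ, χ = (· ^ n)` — the character
group of `S¹` is `ℤ`. [cite: BrockerTomDieck1985, Ch. II Prop. 8.1] -/
theorem existsUnique_zpow (χ : Circle →* Circle) (hχ : Continuous χ) :
    ∃! n : ℤ, ∀ z : Circle, χ z = z ^ n := by
  obtain ⟨n, hn⟩ := eq_zpow χ hχ
  exact ⟨n, hn, fun m hm => zpow_injective' fun z => (hm z).symm.trans (hn z)⟩

/-- A multiplicative character `U(1) → ℂ` never vanishes. [folklore] -/
theorem ne_zero (χ : Circle →* ℂ) (z : Circle) : χ z ≠ 0 := by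
  intro h
  have h1 := χ.map_mul z z⁻¹
  rw [mul_inv_cancel, map_one, h, zero_mul] at h1
  exact one_ne_zero h1

/-- A continuous multiplicative character `U(1) → ℂ` is **unitary**: the image of the compact group is a
bounded subgroup of `ℂˣ`, hence lies on the unit circle. [folklore] -/
theorem norm_eq_one (χ : Circle →* ℂ) (hχ : Continuous χ) (z : Circle) : ‖χ z‖ = 1 := by
  obtain ⟨M, hM⟩ := (isCompact_range hχ).isBounded.exists_norm_le
  have hbd : ∀ w : Circle, ‖χ w‖ ≤ M := fun w => hM _ ⟨w, rfl⟩
  have key : ∀ w : Circle, ¬ 1 < ‖χ w‖ := by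
    intro w hw
    obtain ⟨k, hk⟩ := pow_unbounded_of_one_lt M hw
    have := hbd (w ^ k)
    rw [map_pow, norm_pow] at this
    exact absurd (lt_of_lt_of_le hk this) (lt_irrefl _)
  rcases lt_trichotomy ‖χ z‖ 1 with h | h | h
  · exfalso
    refine key z⁻¹ ?_
    rw [map_inv, norm_inv]
    exact (one_lt_inv₀ (norm_pos_iff.mpr (ne_zero χ z))).mpr h
  · exact h
  · exact absurd h (key z)

/-- Codomain restriction of a continuous character `U(1) → ℂ` to `U(1) → U(1)`. [folklore] -/
def toCircleHom (χ : Circle →* ℂ) (hχ : Continuous χ) : Circle →* Circle where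
  toFun z := ⟨χ z, mem_sphere_zero_iff_norm.mpr (norm_eq_one χ hχ z)⟩
  map_one' := Circle.ext (by simp)
  map_mul' a b := Circle.ext (by simp)

/-- Unfolding `toCircleHom`. [folklore] -/
@[simp] theorem coe_toCircleHom (χ : Circle →* ℂ) (hχ : Continuous χ) (z : Circle) :
    ((toCircleHom χ hχ z : Circle) : ℂ) = χ z := rfl

/-- `toCircleHom χ` is continuous. [folklore] -/
theorem continuous_toCircleHom (χ : Circle →* ℂ) (hχ : Continuous χ) :
    Continuous (toCircleHom χ hχ) :=
  Continuous.subtype_mk hχ _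

/-- **Classification of the continuous characters `U(1) → ℂ`**: `∃! n : ℤ, χ z = z ^ n`.
[cite: BrockerTomDieck1985, Ch. II Prop. 8.1] -/
theorem existsUnique_zpow_complex (χ : Circle →* ℂ) (hχ : Continuous χ) :
    ∃! n : ℤ, ∀ z : Circle, χ z = (z : ℂ) ^ n := by
  obtain ⟨n, hn, huniq⟩ := existsUnique_zpow (toCircleHom χ hχ) (continuous_toCircleHom χ hχ)
  refine ⟨n, fun z => ?_, fun m hm => huniq m fun z => Circle.ext ?_⟩
  · have := congrArg (fun w : Circle => (w : ℂ)) (hn z)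
    simpa using this
  · simpa using hm z

section Line

variable {V : Type*} [NormedAddCommGroup V] [NormedSpace ℂ V]

/-- The scalar by which an operator stabilising the line `ℂ φ` acts on `φ ≠ 0` is unique. [folklore] -/
theorem existsUnique_scalar {φ : V} (hφ : φ ≠ 0) {w : V} (hw : ∃ a : ℂ, w = a • φ) :
    ∃! a : ℂ, w = a • φ := by
  obtain ⟨a, rfl⟩ := hw
  exact ⟨a, rfl, fun b hb => (smul_left_injective ℂ hφ hb).symm⟩

/-- **The weight of a circle action on a stable line.** Let `U(1)` act multiplicatively on a complex normed
space `V` by continuous linear maps `ρ u`, stabilising the line through a non-zero vector `φ`, with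
`u ↦ ρ u φ` continuous.  Then there is a UNIQUE integer `e` with `ρ u φ = u ^ (-e) • φ` for all `u ∈ U(1)`
(Prop. II.8.1 applied to the character of the line; the sign convention `-e` is the one of lowering
weights). [cite: BrockerTomDieck1985, Ch. II Prop. 8.1 and Def. 8.2] -/
theorem existsUnique_lineExponent (ρ : Circle →* (V →L[ℂ] V)) (φ : V) (hφ : φ ≠ 0)
    (hline : ∀ u : Circle, ∃ a : ℂ, ρ u φ = a • φ) (hcont : Continuous fun u : Circle => ρ u φ) :
    ∃! e : ℤ, ∀ u : Circle, ρ u φ = ((u : ℂ) ^ (-e)) • φ := by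
  classical
  -- the scalar character
  choose c hc using hline
  have hc1 : c 1 = 1 := by
    have h : (1 : ℂ) • φ = c 1 • φ := by
      rw [one_smul, ← hc 1, map_one]; rfl
    exact (smul_left_injective ℂ hφ h).symm
  have hcmul : ∀ u v, c (u * v) = c u * c v := by
    intro u v
    have h := hc (u * v)
    rw [map_mul] at h
    change (ρ u) ((ρ v) φ) = c (u * v) • φ at h
    rw [hc v, map_smul, hc u, smul_smul, mul_comm (c v) (c u)] at h
    exact (smul_left_injective ℂ hφ h).symm
  let χ : Circle →* ℂ := { toFun := c, map_one' := hc1, map_mul' := hcmul }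
  -- continuity of the scalar: `a ↦ a • φ` is a closed embedding `ℂ → V`
  let L : ℂ →ₗ[ℂ] V := LinearMap.toSpanSingleton ℂ V φ
  have hL : _root_.Topology.IsClosedEmbedding L :=
    LinearMap.isClosedEmbedding_of_injective (LinearMap.ker_toSpanSingleton ℂ hφ)
  have hχc : Continuous χ := by
    have : (fun u : Circle => ρ u φ) = L ∘ c := by
      funext u; simp [L, hc u]
    rw [this] at hcont
    exact hL.isInducing.continuous_iff.mpr hcont
  obtain ⟨n, hn, huniq⟩ := existsUnique_zpow_complex χ hχc
  refine ⟨-n, fun u => ?_, fun e he => ?_⟩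
  · rw [neg_neg, hc u]
    exact congrArg (· • φ) (hn u)
  · have h1 : -e = n := huniq (-e) fun u => by
      have h := he u
      rw [hc u] at h
      exact smul_left_injective ℂ hφ h
    omega

end Line

end CircleChar

end Literature.RepresentationTheory.CompactGroups

end
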